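import Mathlib
import HarnessLib
import Literature.Computability.AlgebraicComplexity.FlatteningBound
import Summits.MatrixMultiplication.MatrixMultiplication.Theorems.OutsiderSandwichTouchingPoints

/-!
# OutsiderSandwich — the maximal touching exponent `τ*`: the cut of record in ONE real number

Route `route-MatrixMultiplication-OutsiderSandwich`, cut of record
`closes (h₁ : LaserTangency) (h₂ : LaserMergeOptimal) (h₃ : SummitIffLaserTangency)`.
`OutsiderSandwichTouchingPoints` turned both cruxes into statements about single universal spectral
points on the laser floor `x = Λ(τ) := log₂ 3 + (τ - 2)/3` (`τ_F = log₂ F⟨2,2,2⟩`, `x_F = log₂ F(cw₂)`).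
Here the lens-4 («extremal counterexample») reduction is completed: the set

  `T := {τ_F : F universal, x_F = Λ(τ_F)} ⊆ [2, ω]`   (`touchingExponents`)

of TOUCHING EXPONENTS is COMPACT (`isCompact_touchingExponents` — closed by the compactness step
`exists_touching_of_seq₂`, bounded by `two_le_matExp` / `matExp_le_omega`), so it has a largest element
whenever it is nonempty, and with `τ* := sSup T ∈ {0} ∪ [2, ω]`:

* `laserTangency_iff_subset_two`     : `LaserTangency ⟺ T ⊆ {2}`,   `laserTangency_iff_sSup_le` : `⟺ τ* ≤ 2`;
* `laserMergeOptimal_iff_omega_mem`  : `LaserMergeOptimal ⟺ ω ∈ T`, `laserMergeOptimal_iff_sSup_eq` : `⟺ τ* = ω`;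
* `summit_iff_sSup`                  : `ω = 2 ⟺ τ* ≤ 2 ∧ τ* = ω`;
* `laserLettersArePoints_holds`      : the route's aside item `LaserLettersArePoints` (27450) by name;
* `exists_extremal_touching`         : if `LaserTangency` fails there is an EXTREMAL counterexample —
  a universal spectral point ON the floor whose exponent `τ_F = τ* > 2` is maximal among all touching
  points (the «maximal counterexample» of the attacked crux; `LaserMergeOptimal` then says `τ* = ω`).

The gauge corner gives `2 ∈ T` as soon as a universal point with `F⟨2,2,2⟩ = 4`, `F(cw₂) = 3` is
supplied (`two_mem_touchingExponents_of`; the quantum functionals are such points: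
`isUniversalSpectralPoint_quantumFunctionalPoint`, `quantumFunctionalPoint_matMulTensor_two_eq_four`,
`quantumFunctionalPoint_cwTensor_two_eq_three`, in modules not imported here).

References: Strassen, Crelle 384 (1988) Thm. 2.3–2.4; Coppersmith–Winograd, JSC 9 (1990) §6;
Zuiddam, PhD thesis (2018) §2.
-/

-- the problem's namespace `Summit.MatrixMultiplication.MatrixMultiplication` repeats the summit name
set_option linter.dupNamespace false

namespace Summit.MatrixMultiplication.MatrixMultiplication.Theorems.OutsiderSandwichTouchingExponent

open scoped Topology
open Filter
open Literature.Computability.AlgebraicComplexity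
open Summit.MatrixMultiplication.MatrixMultiplication.Theses.OutsiderSandwich
open Summit.MatrixMultiplication.MatrixMultiplication.Theorems.OutsiderSandwichLaserFloor
  (one_le_map_matMulTensor two_le_matExp laserFloor)
open Summit.MatrixMultiplication.MatrixMultiplication.Theorems.OutsiderSandwichLaserFloorCut
  (matExp_le_omega three_le_map_cwTensor)
open Summit.MatrixMultiplication.MatrixMultiplication.Theorems.OutsiderSandwichTouchingPoints
  (le_of_mapClusterPt exists_universal_clusterPt laserTangency_iff_offCorner
    laserMergeOptimal_iff_corner summit_iff_corner_offCorner laserLettersArePoints)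

/-- The class `[⟨2,2,2⟩] ∈ T(ℂ)`. -/
private noncomputable abbrev aMM : TensorClass ℂ := TensorClass.mk (matMulTensor ℂ 2 2 2)
/-- The class `[cw₂] ∈ T(ℂ)`. -/
private noncomputable abbrev aCW : TensorClass ℂ := TensorClass.mk (cwTensor ℂ 2)

/-- The closed region `D = {ψ | 1 ≤ ψ[⟨2,2,2⟩], 3 ≤ ψ[cw₂]}` (contains every universal point). -/
private def regionD : Set (TensorClass ℂ → ℝ) := {ψ | 1 ≤ ψ aMM ∧ 3 ≤ ψ aCW}

/-- `D` is closed. -/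
private theorem isClosed_regionD : IsClosed regionD :=
  (isClosed_le continuous_const (continuous_apply aMM)).inter
    (isClosed_le continuous_const (continuous_apply aCW))

/-- Every universal point lies in `D` (`F⟨2,2,2⟩ ≥ 1`, `F(cw₂) ≥ 3`). -/
private theorem eval_mem_regionD {F : SpectralMap ℂ} (hF : IsUniversalSpectralPoint ℂ F) :
    TensorClass.eval F ∈ regionD := by
  refine ⟨?_, ?_⟩
  · show 1 ≤ TensorClass.eval F (TensorClass.mk (matMulTensor ℂ 2 2 2))
    rw [TensorClass.eval_mk hF]
    exact one_le_map_matMulTensor hF (by norm_num)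
  · show 3 ≤ TensorClass.eval F (TensorClass.mk (cwTensor ℂ 2))
    rw [TensorClass.eval_mk hF]
    exact three_le_map_cwTensor hF

/-- `ψ ↦ log₂ ψ(a)` is continuous on any region where `ψ(a) > 0`. [folklore] -/
private theorem continuousOn_logb_apply (a : TensorClass ℂ) {D : Set (TensorClass ℂ → ℝ)}
    (hD : ∀ ψ ∈ D, 0 < ψ a) :
    ContinuousOn (fun ψ : TensorClass ℂ → ℝ => Real.logb 2 (ψ a)) D := by
  have h1 : ContinuousOn (fun ψ : TensorClass ℂ → ℝ => ψ a) D := (continuous_apply a).continuousOn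
  have h2 : ContinuousOn (fun ψ : TensorClass ℂ → ℝ => Real.log (ψ a)) D :=
    h1.log fun ψ hψ => (hD ψ hψ).ne'
  have e : (fun ψ : TensorClass ℂ → ℝ => Real.logb 2 (ψ a)) =
      fun ψ => Real.log (ψ a) / Real.log 2 := rfl
  rw [e]
  exact h2.div_const _

/-- `τ` is continuous on `D`. -/
private theorem continuousOn_tau : ContinuousOn (fun ψ : TensorClass ℂ → ℝ => Real.logb 2 (ψ aMM)) regionD :=
  continuousOn_logb_apply aMM fun _ hψ => lt_of_lt_of_le one_pos hψ.1

/-- `x` is continuous on `D`. -/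
private theorem continuousOn_x : ContinuousOn (fun ψ : TensorClass ℂ → ℝ => Real.logb 2 (ψ aCW)) regionD :=
  continuousOn_logb_apply aCW fun _ hψ => lt_of_lt_of_le (by norm_num) hψ.2

/-- `Λ(τ)` is continuous on `D`. -/
private theorem continuousOn_floor : ContinuousOn
    (fun ψ : TensorClass ℂ → ℝ => Real.logb 2 3 + (Real.logb 2 (ψ aMM) - 2) / 3) regionD :=
  continuousOn_const.add ((continuousOn_tau.sub continuousOn_const).div_const _)

/-! ## From a sequence of almost-touching universal points to a touching point (two-sided)

The tree lemma `OutsiderSandwichTouchingPoints.exists_touching_of_seq` only transports LOWER test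
bounds on `τ`; closedness of the touching-exponent set needs upper ones too.  The private region
`D` and its continuity lemmas are repeated from that file (they are private there). -/

/-- **Compactness step.**  If for every `n` there is a universal spectral point `F n` with
`x_{F n} ≤ Λ(τ_{F n}) + 1/(n+1)`, `c ≤ τ_{F n} + 1/(n+1)` for every `c` in a set `T` of lower test
values and `τ_{F n} ≤ d + 1/(n+1)` for every `d` in a set `U` of upper test values, then there is a
universal spectral point `G` with `x_G = Λ(τ_G)`, `c ≤ τ_G` for `c ∈ T` and `τ_G ≤ d` for `d ∈ U`.
[cite: Strassen1988, Thm. 2.3] -/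
theorem exists_touching_of_seq₂ (T U : Set ℝ) (F : ℕ → SpectralMap ℂ)
    (hF : ∀ n, IsUniversalSpectralPoint ℂ (F n))
    (hx : ∀ n, Real.logb 2 (F n (cwTensor ℂ 2)) ≤
      Real.logb 2 3 + (Real.logb 2 (F n (matMulTensor ℂ 2 2 2)) - 2) / 3 + 1 / ((n : ℝ) + 1))
    (hT : ∀ c ∈ T, ∀ n, c ≤ Real.logb 2 (F n (matMulTensor ℂ 2 2 2)) + 1 / ((n : ℝ) + 1))
    (hU : ∀ d ∈ U, ∀ n, Real.logb 2 (F n (matMulTensor ℂ 2 2 2)) ≤ d + 1 / ((n : ℝ) + 1)) :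
    ∃ G : SpectralMap ℂ, IsUniversalSpectralPoint ℂ G ∧
      Real.logb 2 (G (cwTensor ℂ 2)) = Real.logb 2 3 + (Real.logb 2 (G (matMulTensor ℂ 2 2 2)) - 2) / 3 ∧
      (∀ c ∈ T, c ≤ Real.logb 2 (G (matMulTensor ℂ 2 2 2))) ∧
      (∀ d ∈ U, Real.logb 2 (G (matMulTensor ℂ 2 2 2)) ≤ d) := by
  obtain ⟨φ, _, hc, hUφ'⟩ := exists_universal_clusterPt F hF
  have hD : ∀ n, (fun n => TensorClass.eval (F n)) n ∈ regionD := fun n => eval_mem_regionD (hF n)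
  have hmm : ∀ n, TensorClass.eval (F n) aMM = F n (matMulTensor ℂ 2 2 2) :=
    fun n => TensorClass.eval_mk (hF n) _
  have hcw : ∀ n, TensorClass.eval (F n) aCW = F n (cwTensor ℂ 2) :=
    fun n => TensorClass.eval_mk (hF n) _
  -- pass `x ≤ Λ(τ) + 1/(n+1)` to the limit
  have hxφ : Real.logb 2 (φ aCW) ≤ Real.logb 2 3 + (Real.logb 2 (φ aMM) - 2) / 3 := by
    refine le_of_mapClusterPt hc isClosed_regionD hD continuousOn_x continuousOn_floor ?_
    intro n
    simp only [hmm, hcw]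
    exact hx n
  -- pass `c ≤ τ + 1/(n+1)` and `τ ≤ d + 1/(n+1)` to the limit
  have hTφ : ∀ c ∈ T, c ≤ Real.logb 2 (φ aMM) := fun c hcT =>
    le_of_mapClusterPt hc isClosed_regionD hD continuousOn_const continuousOn_tau fun n => by
      simpa only [hmm] using hT c hcT n
  have hUφ : ∀ d ∈ U, Real.logb 2 (φ aMM) ≤ d := fun d hdU =>
    le_of_mapClusterPt hc isClosed_regionD hD continuousOn_tau continuousOn_const fun n => by
      simpa only [hmm] using hU d hdU n
  -- the universal point `spectralMapOf φ` has the same coordinates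
  have e1 : TensorClass.spectralMapOf φ (matMulTensor ℂ 2 2 2) = φ aMM :=
    TensorClass.spectralMapOf_apply φ _
  have e2 : TensorClass.spectralMapOf φ (cwTensor ℂ 2) = φ aCW :=
    TensorClass.spectralMapOf_apply φ _
  refine ⟨TensorClass.spectralMapOf φ, hUφ', ?_, fun c hcT => by rw [e1]; exact hTφ c hcT,
    fun d hdU => by rw [e1]; exact hUφ d hdU⟩
  rw [e1, e2]
  have hfl := laserFloor hUφ'
  rw [e1, e2] at hfl
  exact le_antisymm hxφ hfl

/-! ## The set of touching exponents -/

/-- The **touching exponents**: matrix exponents `τ_F = log₂ F⟨2,2,2⟩` of universal spectral points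
`F` lying ON the laser floor, `log₂ F(cw₂) = log₂ 3 + (τ_F - 2)/3`. -/
def touchingExponents : Set ℝ :=
  {t | ∃ F : SpectralMap ℂ, IsUniversalSpectralPoint ℂ F ∧ Real.logb 2 (F (matMulTensor ℂ 2 2 2)) = t ∧
    Real.logb 2 (F (cwTensor ℂ 2)) = Real.logb 2 3 + (t - 2) / 3}

/-- `T ⊆ [2, ω]`. [cite: Strassen1988, Thm. 2.4] -/
theorem touchingExponents_subset_Icc : touchingExponents ⊆ Set.Icc 2 (omega ℂ) := by
  rintro t ⟨F, hF, rfl, -⟩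
  exact ⟨two_le_matExp hF, matExp_le_omega hF⟩

/-- `T` is bounded above (by `ω`). -/
theorem bddAbove_touchingExponents : BddAbove touchingExponents :=
  ⟨omega ℂ, fun _ ht => (touchingExponents_subset_Icc ht).2⟩

/-- **`T` is closed**: a limit of touching exponents is a touching exponent (compactness of the
asymptotic spectrum, via `exists_touching_of_seq₂`). [cite: Strassen1988, Thm. 2.3] -/
theorem isClosed_touchingExponents : IsClosed touchingExponents := by
  refine isSeqClosed_iff_isClosed.1 fun u p hu hp => ?_
  choose F hF hτ hx using hu
  -- a subsequence with `|u (k n) - p| < 1/(n+1)`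
  have hk : ∀ n : ℕ, ∃ k : ℕ, |u k - p| < 1 / ((n : ℝ) + 1) := by
    intro n
    obtain ⟨N, hN⟩ := (Metric.tendsto_atTop.1 hp) (1 / ((n : ℝ) + 1)) (by positivity)
    exact ⟨N, by simpa [Real.dist_eq] using hN N le_rfl⟩
  choose k hk using hk
  obtain ⟨G, hG, hGx, hGT, hGU⟩ := exists_touching_of_seq₂ {p} {p} (fun n => F (k n))
    (fun n => hF (k n))
    (fun n => by
      show Real.logb 2 (F (k n) (cwTensor ℂ 2)) ≤
        Real.logb 2 3 + (Real.logb 2 (F (k n) (matMulTensor ℂ 2 2 2)) - 2) / 3 + 1 / ((n : ℝ) + 1)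
      rw [hx (k n), hτ (k n)]
      have : (0 : ℝ) ≤ 1 / ((n : ℝ) + 1) := by positivity
      linarith)
    (fun c hc n => by
      rw [Set.mem_singleton_iff] at hc
      subst hc
      show c ≤ Real.logb 2 (F (k n) (matMulTensor ℂ 2 2 2)) + 1 / ((n : ℝ) + 1)
      rw [hτ (k n)]
      have h := abs_lt.1 (hk n)
      linarith [h.1, h.2])
    (fun d hd n => by
      rw [Set.mem_singleton_iff] at hd
      subst hd
      show Real.logb 2 (F (k n) (matMulTensor ℂ 2 2 2)) ≤ d + 1 / ((n : ℝ) + 1)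
      rw [hτ (k n)]
      have h := abs_lt.1 (hk n)
      linarith [h.1, h.2])
  have hp' : Real.logb 2 (G (matMulTensor ℂ 2 2 2)) = p :=
    le_antisymm (hGU p rfl) (hGT p rfl)
  refine ⟨G, hG, hp', ?_⟩
  rw [hGx, hp']

/-- **`T` is compact.** [cite: Strassen1988, Thm. 2.3] -/
theorem isCompact_touchingExponents : IsCompact touchingExponents :=
  isCompact_Icc.of_isClosed_subset isClosed_touchingExponents touchingExponents_subset_Icc

/-- The gauge corner: a universal point with `F⟨2,2,2⟩ = 4`, `F(cw₂) = 3` puts `2 ∈ T` (the quantum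
functionals are such points). [cite: ChristandlVranaZuiddam2023, Thm. 4.20] -/
theorem two_mem_touchingExponents_of {F : SpectralMap ℂ} (hF : IsUniversalSpectralPoint ℂ F)
    (h4 : F (matMulTensor ℂ 2 2 2) = 4) (h3 : F (cwTensor ℂ 2) = 3) : (2 : ℝ) ∈ touchingExponents := by
  refine ⟨F, hF, ?_, ?_⟩
  · rw [h4, show (4 : ℝ) = 2 ^ (2 : ℕ) by norm_num, Real.logb_pow, Real.logb_self_eq_one one_lt_two]
    norm_num
  · rw [h3]
    ring

/-! ## The two cruxes as conditions on `T` -/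

/-- **`LaserTangency ⟺ T ⊆ {2}`**: no touching exponent above the gauge corner.
[cite: Strassen1988, Thm. 2.3] -/
theorem laserTangency_iff_subset_two : LaserTangency ↔ touchingExponents ⊆ {2} := by
  rw [laserTangency_iff_offCorner]
  constructor
  · rintro h t ⟨F, hF, rfl, hx⟩
    rw [Set.mem_singleton_iff]
    by_contra hne
    have h2 : 2 < Real.logb 2 (F (matMulTensor ℂ 2 2 2)) :=
      lt_of_le_of_ne (two_le_matExp hF) (Ne.symm hne)
    have := h F hF h2
    linarith
  · intro h F hF hτ
    rcases lt_or_ge (Real.logb 2 3 + (Real.logb 2 (F (matMulTensor ℂ 2 2 2)) - 2) / 3)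
      (Real.logb 2 (F (cwTensor ℂ 2))) with hlt | hle
    · exact hlt
    · have hx := le_antisymm hle (laserFloor hF)
      have hmem : Real.logb 2 (F (matMulTensor ℂ 2 2 2)) ∈ touchingExponents := ⟨F, hF, rfl, hx⟩
      have h2 := Set.mem_singleton_iff.1 (h hmem)
      linarith

/-- **`LaserMergeOptimal ⟺ ω ∈ T`**: the top corner of the floor is a spectral point.
[cite: Strassen1988, Thm. 2.3–2.4] -/
theorem laserMergeOptimal_iff_omega_mem : LaserMergeOptimal ↔ omega ℂ ∈ touchingExponents := by
  rw [laserMergeOptimal_iff_corner]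
  exact ⟨fun ⟨F, hF, hω, hx⟩ => ⟨F, hF, hω, hx⟩, fun ⟨F, hF, hω, hx⟩ => ⟨F, hF, hω, hx⟩⟩

/-! ## The maximal touching exponent `τ* = sSup T` -/

/-- `τ* ≤ ω`. [cite: Strassen1988, Thm. 2.4] -/
theorem sSup_touchingExponents_le_omega : sSup touchingExponents ≤ omega ℂ := by
  rcases touchingExponents.eq_empty_or_nonempty with he | hne
  · rw [he, Real.sSup_empty]
    linarith [omega_two_le ℂ]
  · exact csSup_le hne fun t ht => (touchingExponents_subset_Icc ht).2

/-- `τ* ∈ {0} ∪ [2, ω]`: either `T = ∅` (and `τ* = 0` by the junk value of `sSup ∅`) or `2 ≤ τ*`.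
[cite: Strassen1988, Thm. 2.3] -/
theorem sSup_touchingExponents_eq_zero_or : sSup touchingExponents = 0 ∨ 2 ≤ sSup touchingExponents := by
  rcases touchingExponents.eq_empty_or_nonempty with he | ⟨t, ht⟩
  · exact Or.inl (by rw [he, Real.sSup_empty])
  · exact Or.inr ((touchingExponents_subset_Icc ht).1.trans (le_csSup bddAbove_touchingExponents ht))

/-- **`LaserTangency ⟺ τ* ≤ 2`** (`τ* = sSup T`, `= 0` if `T = ∅`). [cite: Strassen1988, Thm. 2.3] -/
theorem laserTangency_iff_sSup_le : LaserTangency ↔ sSup touchingExponents ≤ 2 := by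
  rw [laserTangency_iff_subset_two]
  constructor
  · intro h
    rcases touchingExponents.eq_empty_or_nonempty with he | hne
    · rw [he, Real.sSup_empty]
      norm_num
    · exact csSup_le hne fun t ht => (Set.mem_singleton_iff.1 (h ht)).le
  · intro h t ht
    have h1 : t ≤ sSup touchingExponents := le_csSup bddAbove_touchingExponents ht
    have h2 : 2 ≤ t := (touchingExponents_subset_Icc ht).1
    rw [Set.mem_singleton_iff]
    linarith

/-- **`LaserMergeOptimal ⟺ τ* = ω`** (compactness: a nonempty `T` contains its supremum).
[cite: Strassen1988, Thm. 2.3–2.4] -/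
theorem laserMergeOptimal_iff_sSup_eq : LaserMergeOptimal ↔ sSup touchingExponents = omega ℂ := by
  rw [laserMergeOptimal_iff_omega_mem]
  constructor
  · intro h
    exact le_antisymm (csSup_le ⟨_, h⟩ fun t ht => (touchingExponents_subset_Icc ht).2)
      (le_csSup bddAbove_touchingExponents h)
  · intro h
    rcases touchingExponents.eq_empty_or_nonempty with he | hne
    · exfalso
      rw [he, Real.sSup_empty] at h
      linarith [omega_two_le ℂ]
    · rw [← h]
      exact isCompact_touchingExponents.sSup_mem hne

/-- **The cut of record in one real number**: with `τ* = sSup T` the maximal touching exponent,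
`ω(ℂ) = 2 ⟺ τ* ≤ 2 ∧ τ* = ω` (`LaserTangency ⟺ τ* ≤ 2`, `LaserMergeOptimal ⟺ τ* = ω`).
[cite: Strassen1988, Thm. 2.3–2.4] -/
theorem summit_iff_sSup :
    _root_.MatrixMultiplication ↔ sSup touchingExponents ≤ 2 ∧ sSup touchingExponents = omega ℂ := by
  rw [← laserTangency_iff_sSup_le, ← laserMergeOptimal_iff_sSup_eq, laserTangency_iff_offCorner,
    laserMergeOptimal_iff_corner, summit_iff_corner_offCorner]
  exact and_comm

/-! ## The extremal counterexample -/

/-- **Extremal touching point.**  If `T` has an element other than possibly `2` — i.e. if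
`LaserTangency` FAILS — then there is a universal spectral point ON the laser floor whose matrix
exponent `τ_F = τ* > 2` is MAXIMAL among all touching points: the maximal counterexample to the
attacked crux.  (`LaserMergeOptimal` holds in that world iff `τ* = ω`.) [cite: Strassen1988, Thm. 2.3] -/
theorem exists_extremal_touching (h : ¬ LaserTangency) :
    ∃ F : SpectralMap ℂ, IsUniversalSpectralPoint ℂ F ∧
      Real.logb 2 (F (matMulTensor ℂ 2 2 2)) = sSup touchingExponents ∧
      Real.logb 2 (F (cwTensor ℂ 2)) = Real.logb 2 3 + (Real.logb 2 (F (matMulTensor ℂ 2 2 2)) - 2) / 3 ∧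
      2 < Real.logb 2 (F (matMulTensor ℂ 2 2 2)) ∧
      ∀ G : SpectralMap ℂ, IsUniversalSpectralPoint ℂ G →
        Real.logb 2 (G (cwTensor ℂ 2)) = Real.logb 2 3 + (Real.logb 2 (G (matMulTensor ℂ 2 2 2)) - 2) / 3 →
        Real.logb 2 (G (matMulTensor ℂ 2 2 2)) ≤ Real.logb 2 (F (matMulTensor ℂ 2 2 2)) := by
  rw [laserTangency_iff_sSup_le, not_le] at h
  have hne : touchingExponents.Nonempty := by
    by_contra he
    rw [Set.not_nonempty_iff_eq_empty] at he
    rw [he, Real.sSup_empty] at h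
    linarith
  obtain ⟨F, hF, hτ, hx⟩ := isCompact_touchingExponents.sSup_mem hne
  refine ⟨F, hF, hτ, by rw [hx, hτ], by rw [hτ]; exact h, fun G hG hGx => ?_⟩
  rw [hτ]
  exact le_csSup bddAbove_touchingExponents ⟨G, hG, rfl, hGx⟩

/-! ## Route item `LaserLettersArePoints` (stmt-MatrixMultiplication-27450, aside, rev 17) by name -/

/-- Item `LaserLettersArePoints` (stmt-MatrixMultiplication-27450) holds:
`(LaserTangency ⟺ ∀ F universal, τ_F > 2 → Λ(τ_F) < x_F) ∧
 (LaserMergeOptimal ⟺ ∃ F universal, τ_F = ω ∧ x_F = Λ(ω))` — proved in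
`OutsiderSandwichTouchingPoints` (`laserLettersArePoints`). -/
theorem laserLettersArePoints_holds :
    Summit.MatrixMultiplication.MatrixMultiplication.Theses.OutsiderSandwich.LaserLettersArePoints :=
  laserLettersArePoints

end Summit.MatrixMultiplication.MatrixMultiplication.Theorems.OutsiderSandwichTouchingExponent
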